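import Summits.HodgeConjecture.HodgeConjecture.Theses.TropicalWeilObstruction
import Summits.HodgeConjecture.HodgeConjecture.Theorems.TropicalWeilObstructionTropicalWeilVanishingFrameSpanThetaCoeff
import Summits.HodgeConjecture.HodgeConjecture.Theorems.TropicalWeilObstructionTropicalWeilVanishingClassPositivityPSDCone
import HarnessLib

/-!
# Route `TropicalWeilObstruction` (Kontsevich's tropical test — NEGATION SINK, exploration, no summit claim):
# the boundary of the calibration cone — I. calibrated cycles: class level and type level

Negation-sink bookkeeping of the cell `pub-hodge-tropical` (seat tropical-1 gen 8); part I of the BOUNDARY series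
(`…BoundaryCalibrated`, `…BoundaryHyperplane`, `…BoundaryFrameSpan`, `…BoundaryVanishing`). The open crux K1
(`TropicalWeilVanishing`, stmt-HodgeConjecture-18478) says that every effective tropical `4`-cycle `Z` on a very general tropical
Weil eightfold `ℝ⁸/Qℤ⁸` has `W(Z) = 0`. By the landed class-level analysis (calibration cone p332805, class positivity κ = 8
p337681/p343407, integrality p345511/p345948) the first classes a counterexample could have are the CALIBRATED lattice points on the
boundary circle `64(q₁² + q₂²) = q₀²` of the calibration cone (e.g. `8θ₄ ± Re w`). This file makes the notion "calibrated"
kernel-exact at the level of classes AND of combinatorial types, at every Weil period `Q ≻ 0`, `QJ = JQ`, for an effective `Z`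
with `cyc Z = q₀ θ₄(Q) + q₁ Re w(Q) + q₂ Im w(Q)` (real `qᵢ`):

* `weilFunctional_eq_of_repr`, `mass_eq_of_repr`, `norm_weilFunctional_and_mass_eq_of_repr` — `W(Z) = 8 det(PQPᴴ)(q₁ - iq₂)`,
  `μ(Z) = Σ_σ w_σ a_σ |η_σ|² = q₀ det(PQPᴴ)`, `q₀ ≥ 0`;
* `norm_weilFunctional_eq_mass_iff_boundary` — **CALIBRATED ⟺ BOUNDARY**: `‖W(Z)‖ = μ(Z)` iff `64(q₁² + q₂²) = q₀²`;
* `re_mul_frameComplexDet_eq_zero_of_boundary`, `exists_collinear_of_boundary` — **BOUNDARY ⟹ COLLINEAR DETERMINANTS**: on the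
  boundary there is `ζ ≠ 0` (`q₀ζ² = -8(q₁ + iq₂)`) with `Re(ζ η_σ) = 0` for EVERY cell: all Gaussian integers `η_σ = det_ℂ L_σ`
  lie on one real line through `0` — the test vector `Re(ζ · conj Ω)` of tropical-2's `Kappa.quadForm_testVector` (p343407) is in
  the kernel of the positive form `cyc Z = Σ w_σ a_σ p_σ ⊗ p_σ`, so it pairs to zero with every `p_σ`, and `⟨p_σ, Re(ζ conj Ω)⟩ =
  24 Re(ζ η_σ)`;
* `norm_weilFunctional_eq_mass_of_collinear` — conversely (every `n`, every period) collinear determinants force `‖W‖ = μ`.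

So "calibrated" is a property of the FRAMES of the cells, i.e. of the combinatorial TYPE (preserved under every realisation of the
type at another period), and reads: all cells are "special Lagrangian of one phase" or partially complex (`η_σ = 0`).
HONEST STATUS. Linear algebra about an OPEN statement; it decides nothing about K1 and nothing about the Hodge conjecture, in either
direction. No definition, no named fact, no sorry.

References: [Zharkov2020TropicalWeil] I. Zharkov, arXiv:2002.02347, §2 (pp. 2–4); [MikhalkinZharkov2014Eigenwave] G. Mikhalkin,
I. Zharkov, LN UMI 15 (2014), Def. 4.2, Prop. 4.3, Thm. 5.4.
-/

set_option linter.dupNamespace false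

noncomputable section

open scoped BigOperators
open Matrix
open Literature.AlgebraicGeometry.Tropical
open Summit.HodgeConjecture.HodgeConjecture.Theorems.TropicalHodgeBound

namespace Summit.HodgeConjecture.HodgeConjecture.Theorems.TropicalWeilVanishing.Boundary

/-! ## §0 Display-only notation (the K3 skeleton's local definitions, verbatim bodies; nothing is defined) -/

/-- `P = [1 | i·1]`, the `n × 2n` matrix of `dz₁ ∧ … ∧ dz_n`. -/
local notation3 (prettyPrint := false) "𝐏⟦" n "⟧" =>
  (Matrix.of fun (k : Fin n) (a : Fin (2 * n)) =>
    (if (a : ℕ) = (k : ℕ) then (1 : ℂ) else 0) + (if (a : ℕ) = (k : ℕ) + n then Complex.I else 0))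

/-- The skeleton's `dzCoord n S`. -/
local notation3 (prettyPrint := false) "dz⟦" n "⟧" S:max =>
  (Matrix.det (Matrix.of fun k a : Fin n =>
    (if (S a : ℕ) = (k : ℕ) then (1 : ℂ) else 0) + (if (S a : ℕ) = (k : ℕ) + n then Complex.I else 0)))

/-- The skeleton's `weilPairing n C` (the value `Ŵ(C)` of `dz ⊗ dz`). -/
local notation3 (prettyPrint := false) "Ŵ⟦" n "⟧" C:max =>
  (∑ S : Fin n → Fin (2 * n), ∑ S' : Fin n → Fin (2 * n),
    dz⟦n⟧ S * dz⟦n⟧ S' / ((Nat.factorial n : ℂ) ^ 2) * ((C S S' : ℝ) : ℂ))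

/-- The hermitian pairing `M̂(C)` (the value of `dz ⊗ dz̄` on `C`). -/
local notation3 (prettyPrint := false) "M̂⟦" n "⟧" C:max =>
  (∑ S : Fin n → Fin (2 * n), ∑ S' : Fin n → Fin (2 * n),
    dz⟦n⟧ S * (starRingEnd ℂ) (dz⟦n⟧ S') / ((Nat.factorial n : ℂ) ^ 2) * ((C S S' : ℝ) : ℂ))

/-- The skeleton's `thetaClass n Q`. -/
local notation3 (prettyPrint := false) "θ⟦" n "⟧" Q:max =>
  (fun S S' : Fin n → Fin (2 * n) => Matrix.det (Matrix.submatrix Q S S'))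

/-- The skeleton's `omegaFrame n` (`Ω = Pᴴ`). -/
local notation3 (prettyPrint := false) "Ω⟦" n "⟧" =>
  (Matrix.of fun (a : Fin (2 * n)) (b : Fin n) =>
    (if (a : ℕ) = (b : ℕ) then (1 : ℂ) else 0) - (if (a : ℕ) = (b : ℕ) + n then Complex.I else 0))

/-- The skeleton's `weilClassC n Q` (`w(Q) = (⋀ⁿQ ⊗ 1)(Ω ⊗ Ω)`). -/
local notation3 (prettyPrint := false) "wC⟦" n "⟧" Q:max =>
  (fun S S' : Fin n → Fin (2 * n) =>
    Matrix.det (Matrix.submatrix (Matrix.map Q ((↑) : ℝ → ℂ) * Ω⟦n⟧) S id) *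
      Matrix.det (Matrix.submatrix (Ω⟦n⟧) S' id))

/-- The skeleton's `weilClassRe n Q` (`w₁ = Re w`). -/
local notation3 (prettyPrint := false) "wRe⟦" n "⟧" Q:max =>
  (fun S S' : Fin n → Fin (2 * n) => Complex.re ((wC⟦n⟧ Q) S S'))

/-- The skeleton's `weilClassIm n Q` (`w₂ = Im w`). -/
local notation3 (prettyPrint := false) "wIm⟦" n "⟧" Q:max =>
  (fun S S' : Fin n → Fin (2 * n) => Complex.im ((wC⟦n⟧ Q) S S'))

/-- `M_Q := ½ · P Q Pᴴ`. -/
local notation3 (prettyPrint := false) "𝐌⟦" n "⟧" Q:max =>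
  ((2 : ℂ)⁻¹ • (𝐏⟦n⟧ * Matrix.map Q ((↑) : ℝ → ℂ) * (𝐏⟦n⟧)ᴴ))

/-- The `Ω`-minor `Ω(S) := det Ω⟦4⟧[S,·]` of a word `S`. -/
local notation3 (prettyPrint := false) "Ωm" S:max => (Matrix.det (Matrix.submatrix (Ω⟦4⟧) S id))

/-- The hermitian MASS `μ(Z) = Σ_σ w_σ a_σ |η_σ|²` of an effective tropical `n`-cycle. Nothing is defined. -/
local notation3 (prettyPrint := false) "μ⟦" n "," Z "⟧" =>
  (∑ σ, ((TropicalTorusCycle.cell Z σ).weight : ℝ) * (TropicalTorusCycle.cell Z σ).latticeVolume *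
    ‖frameComplexDet n (TropicalTorusCycle.cell Z σ).frame‖ ^ 2)

/-! ## §2 Calibrated ⟺ on the boundary of the calibration cone (class level, at every Weil period) -/

/-- `Ŵ` on a real combination of three tables (kernel form). [folklore] -/
theorem weilPairing_lincomb_real (a b c : ℝ) (A B C : (Fin 4 → Fin (2 * 4)) → (Fin 4 → Fin (2 * 4)) → ℝ) :
    Ŵ⟦4⟧ (a • A + b • B + c • C) = (a : ℂ) * Ŵ⟦4⟧ A + (b : ℂ) * Ŵ⟦4⟧ B + (c : ℂ) * Ŵ⟦4⟧ C := by
  simp only [Pi.add_apply, Pi.smul_apply, smul_eq_mul, Complex.ofReal_add, Complex.ofReal_mul, mul_add,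
    Finset.sum_add_distrib, Finset.mul_sum]
  congr 1; congr 1
  all_goals
    refine Finset.sum_congr rfl fun S _ => Finset.sum_congr rfl fun S' _ => ?_
    ring

/-- `M̂` on a real combination of three tables (kernel form). [folklore] -/
theorem hermPairing_lincomb_real (a b c : ℝ) (A B C : (Fin 4 → Fin (2 * 4)) → (Fin 4 → Fin (2 * 4)) → ℝ) :
    M̂⟦4⟧ (a • A + b • B + c • C) = (a : ℂ) * M̂⟦4⟧ A + (b : ℂ) * M̂⟦4⟧ B + (c : ℂ) * M̂⟦4⟧ C := by
  simp only [Pi.add_apply, Pi.smul_apply, smul_eq_mul, Complex.ofReal_add, Complex.ofReal_mul, mul_add,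
    Finset.sum_add_distrib, Finset.mul_sum]
  congr 1; congr 1
  all_goals
    refine Finset.sum_congr rfl fun S _ => Finset.sum_congr rfl fun S' _ => ?_
    ring

variable (Q : Matrix (Fin (2 * 4)) (Fin (2 * 4)) ℝ)

/-- **`W(Z)` in coordinates:** if `cyc Z = q₀ θ₄(Q) + q₁ Re w(Q) + q₂ Im w(Q)` (real `qᵢ`, `QJ = JQ`) then
`W(Z) = 8 · det(P Q Pᴴ) · (q₁ - i q₂)`. [cite: Zharkov2020TropicalWeil, §2] -/
theorem weilFunctional_eq_of_repr (hJ : Q * weilJ 4 = weilJ 4 * Q) (Z : TropicalTorusCycle (2 * 4) 4 Q)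
    {q₀ q₁ q₂ : ℝ} (hq : Z.cyc = q₀ • θ⟦4⟧ Q + q₁ • wRe⟦4⟧ Q + q₂ • wIm⟦4⟧ Q) :
    weilFunctional Z = 8 * (𝐏⟦4⟧ * Q.map ((↑) : ℝ → ℂ) * (𝐏⟦4⟧)ᴴ).det * ((q₁ : ℂ) - Complex.I * (q₂ : ℂ)) := by
  have h4 : (0 : ℕ) < 4 := by norm_num
  rw [stub_weilFunctional_eq_pairing Q Z, hq, weilPairing_lincomb_real, weilPairing_thetaClass_eq_zero h4 Q hJ,
    weilPairing_weilClassRe_eq h4 Q, weilPairing_weilClassIm_eq h4 Q]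
  norm_num
  ring

/-- **`μ(Z)` in coordinates:** `μ(Z) = q₀ · det(P Q Pᴴ)` (`M̂(cyc Z) = μ(Z)`, `M̂(θ₄) = det(PQPᴴ)`, `M̂(Re w) = M̂(Im w) = 0`).
[cite: Zharkov2020TropicalWeil, §2] [cite: MikhalkinZharkov2014Eigenwave, Prop. 4.3] -/
theorem mass_eq_of_repr (hJ : Q * weilJ 4 = weilJ 4 * Q) (Z : TropicalTorusCycle (2 * 4) 4 Q)
    {q₀ q₁ q₂ : ℝ} (hq : Z.cyc = q₀ • θ⟦4⟧ Q + q₁ • wRe⟦4⟧ Q + q₂ • wIm⟦4⟧ Q) :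
    ((μ⟦4, Z⟧ : ℝ) : ℂ) = (q₀ : ℂ) * (𝐏⟦4⟧ * Q.map ((↑) : ℝ → ℂ) * (𝐏⟦4⟧)ᴴ).det := by
  have h4 : (0 : ℕ) < 4 := by norm_num
  rw [← hermPairing_cyc Q Z, hq, hermPairing_lincomb_real, hermPairing_thetaClass_eq_det,
    hermPairing_weilClassRe_eq_zero h4 Q hJ, hermPairing_weilClassIm_eq_zero h4 Q hJ]
  ring

/-- The mass is non-negative (`w_σ > 0`, `a_σ > 0`). [cite: MikhalkinZharkov2014Eigenwave, Prop. 4.3] -/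
theorem mass_nonneg {n : ℕ} {Q' : Matrix (Fin (2 * n)) (Fin (2 * n)) ℝ} (Z : TropicalTorusCycle (2 * n) n Q') :
    0 ≤ μ⟦n, Z⟧ :=
  Finset.sum_nonneg fun _ _ =>
    mul_nonneg (mul_nonneg (Nat.cast_nonneg _) (latticeVolume_pos _).le) (sq_nonneg _)

/-- **`‖W(Z)‖` and `μ(Z)` in coordinates, real form** (`Q ≻ 0`, `QJ = JQ`): with `d = det(P Q Pᴴ) > 0`,
`‖W(Z)‖ = 8 d √(q₁² + q₂²)`, `μ(Z) = q₀ d`, and `q₀ ≥ 0`. [cite: Zharkov2020TropicalWeil, §2] -/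
theorem norm_weilFunctional_and_mass_eq_of_repr (hQ : Q.PosDef) (hJ : Q * weilJ 4 = weilJ 4 * Q)
    (Z : TropicalTorusCycle (2 * 4) 4 Q) {q₀ q₁ q₂ : ℝ}
    (hq : Z.cyc = q₀ • θ⟦4⟧ Q + q₁ • wRe⟦4⟧ Q + q₂ • wIm⟦4⟧ Q) :
    ‖weilFunctional Z‖ = 8 * ((𝐏⟦4⟧ * Q.map ((↑) : ℝ → ℂ) * (𝐏⟦4⟧)ᴴ).det).re * Real.sqrt (q₁ ^ 2 + q₂ ^ 2) ∧
      μ⟦4, Z⟧ = q₀ * ((𝐏⟦4⟧ * Q.map ((↑) : ℝ → ℂ) * (𝐏⟦4⟧)ᴴ).det).re ∧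
      0 < ((𝐏⟦4⟧ * Q.map ((↑) : ℝ → ℂ) * (𝐏⟦4⟧)ᴴ).det).re ∧ 0 ≤ q₀ := by
  have hW := weilFunctional_eq_of_repr Q hJ Z hq
  have hM := mass_eq_of_repr Q hJ Z hq
  have hμ0 := mass_nonneg Z
  obtain ⟨hDre, hDim⟩ := det_frame_mul_map_mul_conjTranspose_pos Q hQ
  generalize hD : (𝐏⟦4⟧ * Q.map ((↑) : ℝ → ℂ) * (𝐏⟦4⟧)ᴴ).det = D at hDre hDim hW hM
  obtain ⟨d, rfl⟩ : ∃ d : ℝ, (d : ℂ) = D := ⟨D.re, Complex.ext (by simp) (by simp [hDim])⟩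
  rw [Complex.ofReal_re] at hDre ⊢
  have hμ : μ⟦4, Z⟧ = q₀ * d := by exact_mod_cast hM
  have hnormW : ‖weilFunctional Z‖ = 8 * d * Real.sqrt (q₁ ^ 2 + q₂ ^ 2) := by
    rw [hW, norm_mul, norm_mul, Complex.norm_real, Real.norm_of_nonneg hDre.le]
    have h8 : ‖(8 : ℂ)‖ = 8 := by simp
    rw [h8, Complex.norm_eq_sqrt_sq_add_sq]
    congr 2
    simp only [Complex.sub_re, Complex.ofReal_re, Complex.mul_re, Complex.I_re, zero_mul, Complex.ofReal_im,
      Complex.I_im, one_mul, sub_self, Complex.sub_im, Complex.mul_im, zero_add]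
    ring
  refine ⟨hnormW, hμ, hDre, ?_⟩
  rw [hμ] at hμ0
  by_contra hneg
  push Not at hneg
  have : q₀ * d < 0 := mul_neg_of_neg_of_pos hneg hDre
  linarith

/-- **CALIBRATED ⟺ ON THE CONE BOUNDARY (class level, at every Weil period).** For `Q ≻ 0` commuting with `J` and an
effective tropical `4`-cycle `Z` with `cyc Z = q₀ θ₄(Q) + q₁ Re w(Q) + q₂ Im w(Q)`: equality `‖W(Z)‖ = μ(Z)` holds in the
calibration inequality `‖W(Z)‖ ≤ μ(Z)` (p332805) iff the class lies on the boundary `64(q₁² + q₂²) = q₀²` of the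
calibration cone. [cite: Zharkov2020TropicalWeil, §2] [cite: MikhalkinZharkov2014Eigenwave, Prop. 4.3 and Thm. 5.4] -/
theorem norm_weilFunctional_eq_mass_iff_boundary (hQ : Q.PosDef) (hJ : Q * weilJ 4 = weilJ 4 * Q)
    (Z : TropicalTorusCycle (2 * 4) 4 Q) {q₀ q₁ q₂ : ℝ}
    (hq : Z.cyc = q₀ • θ⟦4⟧ Q + q₁ • wRe⟦4⟧ Q + q₂ • wIm⟦4⟧ Q) :
    ‖weilFunctional Z‖ = μ⟦4, Z⟧ ↔ 64 * (q₁ ^ 2 + q₂ ^ 2) = q₀ ^ 2 := by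
  obtain ⟨hW, hμ, hd, hq0⟩ := norm_weilFunctional_and_mass_eq_of_repr Q hQ hJ Z hq
  generalize ((𝐏⟦4⟧ * Q.map ((↑) : ℝ → ℂ) * (𝐏⟦4⟧)ᴴ).det).re = d at hW hμ hd
  rw [hW, hμ]
  have hs0 : 0 ≤ Real.sqrt (q₁ ^ 2 + q₂ ^ 2) := Real.sqrt_nonneg _
  have hs2 : Real.sqrt (q₁ ^ 2 + q₂ ^ 2) ^ 2 = q₁ ^ 2 + q₂ ^ 2 := Real.sq_sqrt (by positivity)
  constructor
  · intro h
    have h' : 8 * Real.sqrt (q₁ ^ 2 + q₂ ^ 2) = q₀ := by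
      have : d * (8 * Real.sqrt (q₁ ^ 2 + q₂ ^ 2)) = d * q₀ := by linarith
      exact mul_left_cancel₀ hd.ne' this
    nlinarith [h', hs2]
  · intro h
    have h' : 8 * Real.sqrt (q₁ ^ 2 + q₂ ^ 2) = q₀ := by
      have e : Real.sqrt (q₁ ^ 2 + q₂ ^ 2) = Real.sqrt ((q₀ / 8) ^ 2) := by
        congr 1; linarith
      rw [e, Real.sqrt_sq (by linarith)]
      ring
    calc 8 * d * Real.sqrt (q₁ ^ 2 + q₂ ^ 2) = d * (8 * Real.sqrt (q₁ ^ 2 + q₂ ^ 2)) := by ring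
      _ = q₀ * d := by rw [h']; ring

/-! ## §3 Type level: on the boundary ALL complex determinants `η_σ` lie on one real line -/

/-- `conj Ω(S) = dz(S)` (`Ω = Pᴴ`). [folklore] -/
theorem conj_omegaMinor_eq_dz (S : Fin 4 → Fin (2 * 4)) : (starRingEnd ℂ) (Ωm S) = dz⟦4⟧ S := by
  have h1 : (Ω⟦4⟧).submatrix S id = ((𝐏⟦4⟧).submatrix id S)ᴴ := by
    rw [← frame_conjTranspose_eq, Matrix.conjTranspose_submatrix]
  rw [h1, Matrix.det_conjTranspose, ← dz_eq_det_submatrix, Complex.star_def, Complex.conj_conj]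

/-- The pairing of a Plücker vector with the test vector `y_ζ = Re(ζ · conj Ω)` over all words is `24 · Re(ζ η)`.
[cite: MikhalkinZharkov2014Eigenwave, Prop. 4.3] -/
theorem sum_testVector_mul_pluckerCoord (ζ : ℂ) (L : Matrix (Fin (2 * 4)) (Fin 4) ℤ) :
    ∑ S : Fin 4 → Fin (2 * 4), (ζ * (starRingEnd ℂ) (Ωm S)).re * ((pluckerCoord L S : ℤ) : ℝ) =
      24 * (ζ * frameComplexDet 4 L).re := by
  have h : ∀ S : Fin 4 → Fin (2 * 4), (ζ * (starRingEnd ℂ) (Ωm S)).re * ((pluckerCoord L S : ℤ) : ℝ) =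
      (ζ * (dz⟦4⟧ S * ((pluckerCoord L S : ℤ) : ℂ))).re := by
    intro S
    rw [conj_omegaMinor_eq_dz, ← mul_assoc, show ((pluckerCoord L S : ℤ) : ℂ) = (((pluckerCoord L S : ℤ) : ℝ) : ℂ) by
      push_cast; rfl, Complex.re_mul_ofReal]
  simp_rw [h]
  rw [← Complex.re_sum, ← Finset.mul_sum, sum_dz_mul_pluckerCoord]
  rw [show (ζ * ((Nat.factorial 4 : ℂ) * frameComplexDet 4 L)) = ((24 : ℝ) : ℂ) * (ζ * frameComplexDet 4 L) by
    norm_num [Nat.factorial]; ring, Complex.re_ofReal_mul]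

/-- **ON THE CONE BOUNDARY ALL COMPLEX DETERMINANTS ARE COLLINEAR.** Let `Q ≻ 0` commute with `J` and let the effective tropical
`4`-cycle `Z` have `cyc Z = q₀ θ₄(Q) + q₁ Re w(Q) + q₂ Im w(Q)` ON THE BOUNDARY `64(q₁² + q₂²) = q₀²` of the calibration cone.
Then for every `ζ ∈ ℂ` with `q₀ ζ² = -8 (q₁ + i q₂)` and EVERY cell `σ`: `Re(ζ · η_σ) = 0` — all complex determinants
`η_σ = det_ℂ(L_σ) ∈ ℤ[i]` of the cells lie on the real line `ζ⁻¹ · iℝ`. Proof: the quadratic form of `cyc Z = Σ_σ w_σ a_σ p_σ ⊗ p_σ`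
on the test vector `y_ζ = Re(ζ · conj Ω)` is `Σ_σ w_σ a_σ ⟨p_σ, y_ζ⟩²` on one hand and
`4608 · det M_Q · (q₀|ζ|² + 8 Re((q₁ - iq₂)ζ²)) = 0` on the other (`Kappa.quadForm_testVector`, p343407), and
`⟨p_σ, y_ζ⟩ = 24 Re(ζ η_σ)`. [cite: Zharkov2020TropicalWeil, §2] [cite: MikhalkinZharkov2014Eigenwave, Prop. 4.3 and Thm. 5.4] -/
theorem re_mul_frameComplexDet_eq_zero_of_boundary (hQ : Q.PosDef) (hJ : Q * weilJ 4 = weilJ 4 * Q)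
    (Z : TropicalTorusCycle (2 * 4) 4 Q) {q₀ q₁ q₂ : ℝ}
    (hq : Z.cyc = q₀ • θ⟦4⟧ Q + q₁ • wRe⟦4⟧ Q + q₂ • wIm⟦4⟧ Q) (hbd : 64 * (q₁ ^ 2 + q₂ ^ 2) = q₀ ^ 2)
    (ζ : ℂ) (hζ : (q₀ : ℂ) * ζ ^ 2 = -8 * ((q₁ : ℂ) + Complex.I * (q₂ : ℂ))) (σ : Fin Z.numCells) :
    (ζ * frameComplexDet 4 (Z.cell σ).frame).re = 0 := by
  -- `det M_Q` is real
  obtain ⟨-, hDim⟩ := det_frame_mul_map_mul_conjTranspose_pos Q hQ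
  have hMdet : (𝐌⟦4⟧ Q).det = (2 : ℂ)⁻¹ ^ 4 * (𝐏⟦4⟧ * Q.map ((↑) : ℝ → ℂ) * (𝐏⟦4⟧)ᴴ).det := by
    rw [Matrix.det_smul, Fintype.card_fin]
  have hreal : ((𝐌⟦4⟧ Q).det).im = 0 := by
    rw [hMdet, show ((2 : ℂ)⁻¹) ^ 4 = (((2 : ℝ)⁻¹ ^ 4 : ℝ) : ℂ) by push_cast; ring, Complex.im_ofReal_mul, hDim, mul_zero]
  -- the scalar `q₀|ζ|² + 8 Re((q₁ - iq₂)ζ²)` vanishes on the boundary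
  have hscalar : q₀ * ‖ζ‖ ^ 2 + 8 * ((((q₁ : ℂ) - Complex.I * (q₂ : ℂ)) * ζ ^ 2).re) = 0 := by
    by_cases hq0 : q₀ = 0
    · have h12 : q₁ ^ 2 + q₂ ^ 2 = 0 := by nlinarith [sq_nonneg q₁, sq_nonneg q₂]
      have h1 : q₁ = 0 := by nlinarith [sq_nonneg q₁, sq_nonneg q₂]
      have h2 : q₂ = 0 := by nlinarith [sq_nonneg q₁, sq_nonneg q₂]
      rw [hq0, h1, h2]; simp
    · have hq0c : (q₀ : ℂ) ≠ 0 := by exact_mod_cast hq0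
      have hz2 : ζ ^ 2 = -8 * ((q₁ : ℂ) + Complex.I * (q₂ : ℂ)) / (q₀ : ℂ) := by
        rw [eq_div_iff hq0c, mul_comm, hζ]
      have hprod : (((q₁ : ℂ) - Complex.I * (q₂ : ℂ)) * ζ ^ 2).re = -q₀ / 8 := by
        rw [hz2, show ((q₁ : ℂ) - Complex.I * (q₂ : ℂ)) * (-8 * ((q₁ : ℂ) + Complex.I * (q₂ : ℂ)) / (q₀ : ℂ)) =
          (((-8 * (q₁ ^ 2 + q₂ ^ 2) / q₀ : ℝ)) : ℂ) by
            push_cast; field_simp; ring_nf; rw [Complex.I_sq]; ring, Complex.ofReal_re]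
        field_simp
        nlinarith [hbd]
      have hnorm : ‖ζ‖ ^ 2 = 1 := by
        have h4 : (‖ζ‖ ^ 2) ^ 2 = 1 := by
          rw [← pow_mul, show 2 * 2 = 4 by norm_num, show ‖ζ‖ ^ 4 = ‖ζ ^ 2‖ ^ 2 by rw [norm_pow]; ring, hz2,
            norm_div, norm_mul, Complex.norm_real, div_pow, mul_pow, Real.norm_eq_abs, sq_abs]
          have h8 : ‖(-8 : ℂ)‖ = 8 := by simp
          rw [h8, Complex.sq_norm, Complex.normSq_apply]
          simp only [Complex.add_re, Complex.ofReal_re, Complex.mul_re, Complex.I_re, zero_mul, Complex.ofReal_im,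
            Complex.I_im, one_mul, sub_zero, Complex.add_im, Complex.mul_im, add_zero, zero_add]
          rw [div_eq_one_iff_eq (pow_ne_zero 2 hq0)]
          nlinarith [hbd]
        nlinarith [norm_nonneg ζ, h4, sq_nonneg (‖ζ‖ ^ 2 + 1)]
      rw [hnorm, hprod]; ring
  -- the quadratic form on the test vector vanishes
  have hform := Kappa.quadForm_testVector Q hJ hreal q₀ q₁ q₂ ζ
  rw [hscalar, mul_zero, ← hq] at hform
  -- as a sum of positive multiples of squares
  have hsq := FrameSpan.sum_sum_mul_cyc_eq Z (fun S : Fin 4 → Fin (2 * 4) => S)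
    (fun S => (ζ * (starRingEnd ℂ) (Ωm S)).re)
  have hform' : ∑ t : Fin 4 → Fin (2 * 4), ∑ r : Fin 4 → Fin (2 * 4), (ζ * (starRingEnd ℂ) (Ωm t)).re *
      (ζ * (starRingEnd ℂ) (Ωm r)).re * Z.cyc t r = 0 := by
    rw [← hform]
    exact Finset.sum_congr rfl fun t _ => Finset.sum_congr rfl fun r _ => by ring
  rw [hform'] at hsq
  have hterm := (Finset.sum_eq_zero_iff_of_nonneg fun σ _ =>
    mul_nonneg (mul_nonneg (Nat.cast_nonneg _) (latticeVolume_pos _).le) (sq_nonneg _)).mp hsq.symm σ (Finset.mem_univ σ)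
  have hwa : (0 : ℝ) < ((Z.cell σ).weight : ℝ) * (Z.cell σ).latticeVolume :=
    mul_pos (by exact_mod_cast (Z.cell σ).weight_pos) (latticeVolume_pos _)
  have hinner : (∑ t : Fin 4 → Fin (2 * 4), (ζ * (starRingEnd ℂ) (Ωm t)).re *
      ((pluckerCoord (Z.cell σ).frame t : ℤ) : ℝ)) = 0 := by
    have := (mul_eq_zero.mp hterm).resolve_left hwa.ne'
    exact pow_eq_zero_iff (n := 2) (by norm_num) |>.mp this
  rw [sum_testVector_mul_pluckerCoord] at hinner
  linarith

/-- **COLLINEAR DETERMINANTS ⟹ CALIBRATED** (every `n`, every period, no hypothesis on `Q`): if all complex determinants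
`η_σ` of the cells of an effective tropical `n`-cycle lie on one real line through `0` (`Re(ζ η_σ) = 0` for a fixed `ζ ≠ 0`),
then `‖W(Z)‖ = μ(Z)`: all `η_σ²` lie on the ray `-ζ̄² · ℝ_{≥0}`, so the triangle inequality `‖Σ w_σ a_σ η_σ²‖ ≤ Σ w_σ a_σ |η_σ|²`
is an equality. [cite: Zharkov2020TropicalWeil, §2] -/
theorem norm_weilFunctional_eq_mass_of_collinear {n : ℕ} {Q' : Matrix (Fin (2 * n)) (Fin (2 * n)) ℝ}
    (Z : TropicalTorusCycle (2 * n) n Q') (ζ : ℂ) (hζ : ζ ≠ 0)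
    (h : ∀ σ, (ζ * frameComplexDet n (Z.cell σ).frame).re = 0) : ‖weilFunctional Z‖ = μ⟦n, Z⟧ := by
  -- `ζ η_σ = i s_σ` with `s_σ` real
  obtain ⟨s, hs⟩ : ∃ s : Fin Z.numCells → ℝ, ∀ σ, ζ * frameComplexDet n (Z.cell σ).frame = (s σ : ℂ) * Complex.I :=
    ⟨fun σ => (ζ * frameComplexDet n (Z.cell σ).frame).im, fun σ => Complex.ext (by simp [h σ]) (by simp)⟩
  -- `ζ² W = - Σ w a s²`
  have hW : ζ ^ 2 * weilFunctional Z =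
      -(((∑ σ, ((Z.cell σ).weight : ℝ) * (Z.cell σ).latticeVolume * (s σ) ^ 2 : ℝ)) : ℂ) := by
    unfold weilFunctional
    rw [Finset.mul_sum, Complex.ofReal_sum, ← Finset.sum_neg_distrib]
    refine Finset.sum_congr rfl fun σ _ => ?_
    have e : ζ ^ 2 * (((Z.cell σ).weight : ℂ) * ((Z.cell σ).latticeVolume : ℂ) * frameComplexDet n (Z.cell σ).frame ^ 2) =
        ((Z.cell σ).weight : ℂ) * ((Z.cell σ).latticeVolume : ℂ) * (ζ * frameComplexDet n (Z.cell σ).frame) ^ 2 := by ring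
    rw [e, hs σ]
    push_cast
    rw [mul_pow, Complex.I_sq]
    ring
  have hS0 : 0 ≤ ∑ σ, ((Z.cell σ).weight : ℝ) * (Z.cell σ).latticeVolume * (s σ) ^ 2 :=
    Finset.sum_nonneg fun _ _ => mul_nonneg (mul_nonneg (Nat.cast_nonneg _) (latticeVolume_pos _).le) (sq_nonneg _)
  -- norms
  have hn : ‖ζ‖ ^ 2 * ‖weilFunctional Z‖ = ∑ σ, ((Z.cell σ).weight : ℝ) * (Z.cell σ).latticeVolume * (s σ) ^ 2 := by
    rw [← norm_pow, ← norm_mul, hW, norm_neg, Complex.norm_real, Real.norm_of_nonneg hS0]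
  have hs2 : ∀ σ, (s σ) ^ 2 = ‖ζ‖ ^ 2 * ‖frameComplexDet n (Z.cell σ).frame‖ ^ 2 := by
    intro σ
    have e := congrArg (fun z : ℂ => ‖z‖) (hs σ)
    simp only [norm_mul, Complex.norm_real, Complex.norm_I, mul_one, Real.norm_eq_abs] at e
    rw [← sq_abs, ← e]
    ring
  simp_rw [hs2] at hn
  have hn' : ‖ζ‖ ^ 2 * ‖weilFunctional Z‖ = ‖ζ‖ ^ 2 * μ⟦n, Z⟧ := by
    rw [hn, Finset.mul_sum]
    exact Finset.sum_congr rfl fun σ _ => by ring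
  exact mul_left_cancel₀ (pow_ne_zero 2 (norm_ne_zero_iff.mpr hζ)) hn'

/-- A non-empty effective cycle has `cyc Z ≠ 0`, so a representation with `q₀ = q₁ = q₂ = 0` forces `Z` to be empty. [folklore] -/
theorem numCells_eq_zero_of_repr_zero (Z : TropicalTorusCycle (2 * 4) 4 Q) {q₀ q₁ q₂ : ℝ}
    (hq : Z.cyc = q₀ • θ⟦4⟧ Q + q₁ • wRe⟦4⟧ Q + q₂ • wIm⟦4⟧ Q) (h0 : q₀ = 0) (h1 : q₁ = 0) (h2 : q₂ = 0) :
    Z.numCells = 0 := by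
  by_contra hne
  have hZ : 0 < Z.numCells := Nat.pos_of_ne_zero hne
  refine FrameSpan.cyc_ne_zero Z hZ ?_
  rw [hq, h0, h1, h2, zero_smul, zero_smul, zero_smul, add_zero, add_zero]

/-- **On the boundary there is a phase `ζ ≠ 0` with `Re(ζ η_σ) = 0` for every cell** (`ζ² = -8(q₁ + iq₂)/q₀` if `q₀ ≠ 0`;
if `q₀ = 0` the cycle is empty). [cite: Zharkov2020TropicalWeil, §2] [cite: MikhalkinZharkov2014Eigenwave, Prop. 4.3 and Thm. 5.4] -/
theorem exists_collinear_of_boundary (hQ : Q.PosDef) (hJ : Q * weilJ 4 = weilJ 4 * Q)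
    (Z : TropicalTorusCycle (2 * 4) 4 Q) {q₀ q₁ q₂ : ℝ}
    (hq : Z.cyc = q₀ • θ⟦4⟧ Q + q₁ • wRe⟦4⟧ Q + q₂ • wIm⟦4⟧ Q) (hbd : 64 * (q₁ ^ 2 + q₂ ^ 2) = q₀ ^ 2) :
    ∃ ζ : ℂ, ζ ≠ 0 ∧ ∀ σ, (ζ * frameComplexDet 4 (Z.cell σ).frame).re = 0 := by
  by_cases hq0 : q₀ = 0
  · have h1 : q₁ = 0 := by nlinarith [sq_nonneg q₁, sq_nonneg q₂]
    have h2 : q₂ = 0 := by nlinarith [sq_nonneg q₁, sq_nonneg q₂]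
    have hZ := numCells_eq_zero_of_repr_zero Q Z hq hq0 h1 h2
    refine ⟨1, one_ne_zero, fun σ => ?_⟩
    exact absurd σ.2 (by omega)
  · have hq0c : (q₀ : ℂ) ≠ 0 := by exact_mod_cast hq0
    obtain ⟨ζ, hζ⟩ := IsAlgClosed.exists_pow_nat_eq (-8 * ((q₁ : ℂ) + Complex.I * (q₂ : ℂ)) / (q₀ : ℂ)) (by norm_num : 0 < 2)
    have hζ' : (q₀ : ℂ) * ζ ^ 2 = -8 * ((q₁ : ℂ) + Complex.I * (q₂ : ℂ)) := by
      rw [hζ]; field_simp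
    refine ⟨ζ, ?_, re_mul_frameComplexDet_eq_zero_of_boundary Q hQ hJ Z hq hbd ζ hζ'⟩
    intro hz
    rw [hz, zero_pow two_ne_zero, mul_zero] at hζ'
    have h12 : (q₁ : ℂ) + Complex.I * (q₂ : ℂ) = 0 := by
      have := hζ'.symm
      simpa using this
    have h1 : q₁ = 0 := by have := congrArg Complex.re h12; simpa using this
    have h2 : q₂ = 0 := by have := congrArg Complex.im h12; simpa using this
    apply hq0
    nlinarith [hbd]

end Summit.HodgeConjecture.HodgeConjecture.Theorems.TropicalWeilVanishing.Boundary

end
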